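import Literature.Geometry.Riemannian.HamiltonCurvatureODE

/-!
# Crux-triage r1 k3 — witness against the LITERAL first lemma of card `margerin-certified-cone` (published as Cruxes/ChangGurskyYang/TriageR1K3Witness.lean; folder copy W5.lean)

The card's Sketch (`Cruxes/ChangGurskyYang/SketchIdeator3.lean`, namespace `…Sketch3`) states
`MargerinPolynomialNonpos : ∀ p : HamiltonODE.Blocks, 0 < scalB p → wpNum p ≤ (1/6) scalB p ^ 2 → F p ≤ 0`
over ALL block triples `(A, B, C)` — with NO symmetry of `A`, `C` and NO Bianchi condition `tr A = tr C`.
Off the symmetric locus it is false: for `A = 1 + K`, `K` antisymmetric, `B = 0`, `C = 1` one gets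
`F = 144 a³ k²  > 0` (here `a = k = 1`: `scalB = 6`, `wpNum = 2 ≤ 6 = scalB²/6`, `F = 144`).
The definitions below are copied VERBATIM from the sketch (only the namespace differs), so
`not_MargerinPolynomialNonpos` refutes the sketch's statement as typed. Repair (= the sibling cards
`margerin-cone-hamilton-rails` / `margerin-block-polynomial`): restrict to `A, C` symmetric, `tr A = tr C`.
-/

noncomputable section

open scoped Matrix BigOperators
open Literature.Geometry.Riemannian

namespace TriageR1K3

/-! ## Verbatim copies of the sketch's definitions (Sketch3) -/

def frob (M : Matrix (Fin 3) (Fin 3) ℝ) : ℝ := ∑ i, ∑ j, (M i j) ^ 2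
def frobInner (M N : Matrix (Fin 3) (Fin 3) ℝ) : ℝ := ∑ i, ∑ j, M i j * N i j
def tf (M : Matrix (Fin 3) (Fin 3) ℝ) : Matrix (Fin 3) (Fin 3) ℝ := M - (M.trace / 3) • (1 : Matrix (Fin 3) (Fin 3) ℝ)
def wpNum (p : HamiltonODE.Blocks) : ℝ := frob (tf p.1) + frob (tf p.2.2) + 2 * frob p.2.1
def scalB (p : HamiltonODE.Blocks) : ℝ := p.1.trace + p.2.2.trace
def margerinCone (c : ℝ) : Set HamiltonODE.Blocks :=
  {p | 0 ≤ scalB p ∧ wpNum p ≤ c * scalB p ^ 2}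
def dWpNum (p q : HamiltonODE.Blocks) : ℝ :=
  2 * frobInner (tf p.1) (tf q.1) + 2 * frobInner (tf p.2.2) (tf q.2.2) + 4 * frobInner p.2.1 q.2.1
def MargerinPolynomialNonpos : Prop :=
  ∀ p : HamiltonODE.Blocks, 0 < scalB p → wpNum p ≤ (1 / 6 : ℝ) * scalB p ^ 2 →
    dWpNum p (HamiltonODE.field p) * scalB p ^ 2
      - wpNum p * (2 * scalB p * scalB (HamiltonODE.field p)) ≤ 0
def MargerinPolynomialNeg : Prop :=
  ∀ p : HamiltonODE.Blocks, 0 < scalB p → 0 < wpNum p → wpNum p < (1 / 6 : ℝ) * scalB p ^ 2 →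
    dWpNum p (HamiltonODE.field p) * scalB p ^ 2
      - wpNum p * (2 * scalB p * scalB (HamiltonODE.field p)) < 0

/-! ## The witness `p₀ = (1 + K, 0, 1)`, `K = e₁ ∧ e₂` -/

def A0 : Matrix (Fin 3) (Fin 3) ℝ := !![1, -1, 0; 1, 1, 0; 0, 0, 1]
/-- `field p₀ = (A1, 0, 3•1)` with `A1 = A0² + 2 A0^#`. -/
def A1 : Matrix (Fin 3) (Fin 3) ℝ := !![2, -4, 0; 4, 2, 0; 0, 0, 5]
def p0 : HamiltonODE.Blocks := (A0, 0, 1)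

theorem sharp_A0 : A0.sharp = !![1, -1, 0; 1, 1, 0; 0, 0, 2] := by
  ext i j
  fin_cases i <;> fin_cases j <;>
    simp [Matrix.sharp, Matrix.adjugate_fin_three, A0] <;> norm_num

theorem sharp_one3 : (1 : Matrix (Fin 3) (Fin 3) ℝ).sharp = 1 := by
  simp [Matrix.sharp, Matrix.adjugate_one]

theorem sharp_zero3 : (0 : Matrix (Fin 3) (Fin 3) ℝ).sharp = 0 := by
  simp [Matrix.sharp, Matrix.adjugate_zero]

theorem field_p0 :
    HamiltonODE.field p0 = (A1, 0, (3 : ℝ) • (1 : Matrix (Fin 3) (Fin 3) ℝ)) := by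
  simp only [HamiltonODE.field, p0]
  refine Prod.ext ?_ (Prod.ext ?_ ?_)
  · change A0 * A0 + 0 * (0 : Matrix (Fin 3) (Fin 3) ℝ)ᵀ + (2 : ℝ) • A0.sharp = A1
    rw [sharp_A0]
    ext i j
    fin_cases i <;> fin_cases j <;>
      simp [A0, A1, Matrix.mul_apply, Fin.sum_univ_three] <;> norm_num
  · change A0 * 0 + 0 * (1 : Matrix (Fin 3) (Fin 3) ℝ) + (2 : ℝ) • (0 : Matrix (Fin 3) (Fin 3) ℝ).sharp = 0
    rw [sharp_zero3]
    simp
  · change (1 : Matrix (Fin 3) (Fin 3) ℝ) * 1 + (0 : Matrix (Fin 3) (Fin 3) ℝ)ᵀ * 0 +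
        (2 : ℝ) • (1 : Matrix (Fin 3) (Fin 3) ℝ).sharp = (3 : ℝ) • 1
    rw [sharp_one3]
    ext i j
    fin_cases i <;> fin_cases j <;> simp [Matrix.one_apply] <;> norm_num

theorem scalB_p0 : scalB p0 = 6 := by
  simp [scalB, p0, A0, Matrix.trace, Fin.sum_univ_three, Matrix.one_apply]
  norm_num

theorem wpNum_p0 : wpNum p0 = 2 := by
  simp [wpNum, frob, tf, p0, A0, Matrix.trace, Fin.sum_univ_three, Matrix.smul_apply,
    Matrix.one_apply, Matrix.sub_apply]
  norm_num

theorem scalB_field_p0 : scalB (HamiltonODE.field p0) = 18 := by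
  rw [field_p0]
  simp [scalB, A1, Matrix.trace, Fin.sum_univ_three, Matrix.smul_apply, Matrix.one_apply]
  norm_num

theorem dWpNum_p0 : dWpNum p0 (HamiltonODE.field p0) = 16 := by
  rw [field_p0]
  simp [dWpNum, frobInner, tf, p0, A0, A1, Matrix.trace, Fin.sum_univ_three, Matrix.smul_apply,
    Matrix.one_apply, Matrix.sub_apply]
  norm_num

/-- `p₀` lies in the closed `1/6`-cone (indeed on the boundary of the `1/18`-cone) with `scalB > 0`. -/
theorem p0_mem : p0 ∈ margerinCone (1 / 18) ∧ 0 < scalB p0 ∧ wpNum p0 < (1 / 6 : ℝ) * scalB p0 ^ 2 := by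
  refine ⟨⟨?_, ?_⟩, ?_, ?_⟩ <;> simp only [scalB_p0, wpNum_p0] <;> norm_num

/-- **The literal first lemma of card `margerin-certified-cone` is false**: `F(p₀) = 144 > 0`. -/
theorem not_MargerinPolynomialNonpos : ¬ MargerinPolynomialNonpos := by
  intro h
  have := h p0 (by rw [scalB_p0]; norm_num) (by rw [wpNum_p0, scalB_p0]; norm_num)
  rw [dWpNum_p0, scalB_p0, wpNum_p0, scalB_field_p0] at this
  norm_num at this

/-- The strict companion is false by the same witness (`0 < wpNum p₀ = 2 < 6`). -/
theorem not_MargerinPolynomialNeg : ¬ MargerinPolynomialNeg := by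
  intro h
  have := h p0 (by rw [scalB_p0]; norm_num) (by rw [wpNum_p0]; norm_num)
    (by rw [wpNum_p0, scalB_p0]; norm_num)
  rw [dWpNum_p0, scalB_p0, wpNum_p0, scalB_field_p0] at this
  norm_num at this

/-- The value of Margerin's polynomial at the witness: `F(p₀) = 16·36 − 2·(2·6·18) = 144`. -/
theorem F_p0 : dWpNum p0 (HamiltonODE.field p0) * scalB p0 ^ 2
    - wpNum p0 * (2 * scalB p0 * scalB (HamiltonODE.field p0)) = 144 := by
  rw [dWpNum_p0, scalB_p0, wpNum_p0, scalB_field_p0]; norm_num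

end TriageR1K3

end
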